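import Literature.NumberTheory.Automorphic.UnitaryThreePHTowerIndex          -- (F3c-β-ii) FILE C: `mem_flickerHK_iff_of_coe_eq_borel`; FILE B: `coe_inv_mul_of_coe_eq`
import HarnessLib

/-!
# The tower for Flicker's Prop. 8 (ii), FILE E: the `S = P_H ∩ H^K_m`-coset relation on `P_H` IN COORDINATES — when do `p(u,x,w)` and `p(u′,x′,w′)` lie in the
# same left coset of `S`? (Flicker 1998, Prop. 8 pp. 84–85; the precision-`2m−N` counts of Prop. 13 (e) ∕ Prop. 10 read the cosets at this level)

Topic `NumberTheory/Automorphic`; namespace `Literature.NumberTheory.Automorphic.UnitaryGroup`.  THEOREMS ONLY (no `def`, no instance, no notation, no named fact,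
no `sorry`).  Cell `pub/hodgecm-mathlib`, F0∕P3a road «N7-ns COUNT FROM FLICKER» (MAP v3, architect A-p06 (g26)), brick **(F3c-β-ii) FILE E** (B-p04 (g33), 06:05Z; asked
for by F0P3b-p01 (g6) 06:00:28Z and F0P3a-p04 (g12) 05:43:14Z: the case-(e) count of Prop. 13 at precision `2m − N > m` lies BEYOND the reduction `ρ_m` of FILE B, so
it needs the `S`-cosets themselves in the coordinates `(u, x, w)`).  Over ★ FILE B `coe_inv_mul_of_coe_eq` (`p⁻¹p′ = p(u′∕u, x′ − x·N(u)∕N(u′), w′∕w)`) and ★ FILE C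
`mem_flickerHK_iff_of_coe_eq_borel` (★ (C2) for an element of `P_H`).  HC_CM is proved only modulo the printed citations until rung 0 closes; pays nothing by itself.

* **`inv_mul_mem_flickerHK_iff_of_coe_eq`** (raw): `p⁻¹p′ ∈ H^K_m ⟺ |α − β| ≤ |ϖ^m| ∧ |(σα)⁻¹ − β| ≤ |ϖ^m| ∧ |α(1+x₁) + (σα)⁻¹ − 2β| ≤ |ϖ^m|²`
  (`α = u′∕u`, `β = w′∕w`, `x₁ = x′ − x·uσu∕(u′σu′)`).
* **`inv_mul_mem_flickerHK_iff_norm`** (normal form, `|u| = |w| = … = 1`, `σw·w = 1`):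
  `p⁻¹p′ ∈ H^K_m ⟺ |u w⁻¹ − u′ w′⁻¹| ≤ |ϖ^m| ∧ |u′σu′·(1 + x′) + uσu·(1 − x) − 2·u·σu′·w′w⁻¹| ≤ |ϖ^m|²` — the middle raw congruence follows from the first
  (`(σα)⁻¹ − β = −(σα)⁻¹β·σ(α−β)`), the third is the raw third times the unit `u·σu′`.  With FILE B (`ρ_m`) and FILE C∕D (`χ`, the fibres) this completes the
  coordinate description of `P_H ⧸ S`.

## References
* [Flicker1998UnitaryFL] Y. Z. Flicker, *Elementary proof of the fundamental lemma for a unitary group*, Canad. J. Math. 50 (1998), Prop. 8 pp. 84–85; Prop. 13 pp. 91–93.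
-/

open scoped MatrixGroups WithZero Valued
open Matrix

namespace Literature.NumberTheory.Automorphic

namespace UnitaryGroup

open Literature.NumberTheory.Automorphic.HermitianLattice (unitaryInt mem_unitaryInt_iff LocalConjDatum)

section Cosets

variable {K : Type*} [Field K] [Valued K ℤᵐ⁰] {ϖ : K} (σ : K →+* K) {J : Matrix (Fin 3) (Fin 3) K} (hJ : J = (StdForm.antidiagonal 3).over K)

include hJ in
/-- **THE `S`-RELATION IN COORDINATES (raw form).**  For `p = p(u,x,w)`, `p′ = p(u′,x′,w′) ∈ P_H` (★ `exists_coe_eq_borel_of_mem_flickerPH`) and `S = P_H ∩ H^K_m`: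
`p⁻¹p′ ∈ H^K_m ⟺` ★ (C2)'s three congruences for `p⁻¹p′ = p(u′∕u, x′ − x·N(u)∕N(u′), w′∕w)`:
`|u′∕u − w′∕w| ≤ |ϖ^m|`, `|(σ(u′∕u))⁻¹ − w′∕w| ≤ |ϖ^m|`, `|α(1 + x₁) + (σα)⁻¹ − 2β| ≤ |ϖ^m|²` (`α = u′∕u`, `β = w′∕w`, `x₁ = x′ − x·uσu∕(u′σu′)`).
[cite: Flicker1998UnitaryFL, Prop. 8 pp. 84–85] -/
theorem inv_mul_mem_flickerHK_iff_of_coe_eq (hd : LocalConjDatum σ ϖ) {y : K} (hy : y * σ y = -2) (m : ℕ)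
    {um c p p' : ↥(unitaryGroupOfForm σ J)}
    (hum : ((um : GL (Fin 3) K) : Matrix (Fin 3) (Fin 3) K) = !![ϖ ^ m, y, (ϖ ^ m)⁻¹; 0, 1, -σ y * (ϖ ^ m)⁻¹; 0, 0, (ϖ ^ m)⁻¹])
    (hp : p ∈ flickerPH σ J c) (hp' : p' ∈ flickerPH σ J c) {u x w u' x' w' : K}
    (hcoe : ((p : GL (Fin 3) K) : Matrix (Fin 3) (Fin 3) K) = !![u, 0, u * x; 0, w, 0; 0, 0, (σ u)⁻¹])
    (hcoe' : ((p' : GL (Fin 3) K) : Matrix (Fin 3) (Fin 3) K) = !![u', 0, u' * x'; 0, w', 0; 0, 0, (σ u')⁻¹])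
    (hu0 : u ≠ 0) (hw0 : w ≠ 0) (hu0' : u' ≠ 0) :
    p⁻¹ * p' ∈ flickerHK σ J c um ↔
      Valued.v (u' / u - w' / w) ≤ Valued.v (ϖ ^ m) ∧ Valued.v ((σ (u' / u))⁻¹ - w' / w) ≤ Valued.v (ϖ ^ m) ∧
        Valued.v (u' / u + u' / u * (x' - x * (u * σ u) / (u' * σ u')) + (σ (u' / u))⁻¹ - 2 * (w' / w)) ≤
          Valued.v (ϖ ^ m) * Valued.v (ϖ ^ m) := by
  have hmem : p⁻¹ * p' ∈ flickerPH σ J c := Subgroup.mul_mem _ (Subgroup.inv_mem _ hp) hp'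
  exact mem_flickerHK_iff_of_coe_eq_borel σ hJ hd hy m hum hmem (coe_inv_mul_of_coe_eq σ hd.σσ hcoe hcoe' hu0 hw0 hu0')

include hJ in
/-- **THE `S`-RELATION IN COORDINATES (normal form).**  For `p = p(u,x,w)`, `p′ = p(u′,x′,w′) ∈ P_H` with the coordinate facts of ★ `exists_coe_eq_borel_of_mem_flickerPH`
(`|u| = |u′| = |w| = |w′| = 1`, `σw·w = σw′·w′ = 1`):
`p⁻¹ p′ ∈ H^K_m ⟺ |u w⁻¹ − u′ w′⁻¹| ≤ |ϖ^m| ∧ |u′σu′·(1 + x′) + uσu·(1 − x) − 2·u·σu′·w′·w⁻¹| ≤ |ϖ^m|²`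
(the middle congruence of the raw form follows from the first: `(σα)⁻¹ − β = −(σα)⁻¹β·σ(α − β)`; the third is the raw third times the unit `u·σu′`).  This is the
`(u, x, w)`-reading of the cosets of `S = P_H ∩ H^K_m` that the precision-`2m−N` counts of Prop. 13 (e) ∕ Prop. 10 need beyond `ρ_m`.
[cite: Flicker1998UnitaryFL, Prop. 8 pp. 84–85; Prop. 13 pp. 91–93] -/
theorem inv_mul_mem_flickerHK_iff_norm (hd : LocalConjDatum σ ϖ) {y : K} (hy : y * σ y = -2) (m : ℕ)
    {um c p p' : ↥(unitaryGroupOfForm σ J)}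
    (hum : ((um : GL (Fin 3) K) : Matrix (Fin 3) (Fin 3) K) = !![ϖ ^ m, y, (ϖ ^ m)⁻¹; 0, 1, -σ y * (ϖ ^ m)⁻¹; 0, 0, (ϖ ^ m)⁻¹])
    (hp : p ∈ flickerPH σ J c) (hp' : p' ∈ flickerPH σ J c) {u x w u' x' w' : K}
    (hcoe : ((p : GL (Fin 3) K) : Matrix (Fin 3) (Fin 3) K) = !![u, 0, u * x; 0, w, 0; 0, 0, (σ u)⁻¹])
    (hcoe' : ((p' : GL (Fin 3) K) : Matrix (Fin 3) (Fin 3) K) = !![u', 0, u' * x'; 0, w', 0; 0, 0, (σ u')⁻¹])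
    (hu : Valued.v u = 1) (hw : Valued.v w = 1) (hσw : σ w * w = 1) (hu' : Valued.v u' = 1) (hw' : Valued.v w' = 1) (hσw' : σ w' * w' = 1) :
    p⁻¹ * p' ∈ flickerHK σ J c um ↔
      Valued.v (u * w⁻¹ - u' * w'⁻¹) ≤ Valued.v (ϖ ^ m) ∧
        Valued.v (u' * σ u' * (1 + x') + u * σ u * (1 - x) - 2 * (u * σ u' * (w' * w⁻¹))) ≤ Valued.v (ϖ ^ m) * Valued.v (ϖ ^ m) := by
  have hσσ : ∀ a, σ (σ a) = a := hd.σσ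
  have hσv : ∀ a, Valued.v (σ a) = Valued.v a := hd.vσ
  have hu0 : u ≠ 0 := fun h => by rw [h, map_zero] at hu; exact zero_ne_one hu
  have hw0 : w ≠ 0 := fun h => by rw [h, map_zero] at hw; exact zero_ne_one hw
  have hu0' : u' ≠ 0 := fun h => by rw [h, map_zero] at hu'; exact zero_ne_one hu'
  have hw0' : w' ≠ 0 := fun h => by rw [h, map_zero] at hw'; exact zero_ne_one hw'
  have hσu0 : σ u ≠ 0 := fun h => hu0 (by rw [← hσσ u, h, map_zero])
  have hσu0' : σ u' ≠ 0 := fun h => hu0' (by rw [← hσσ u', h, map_zero])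
  have vσu : Valued.v (σ u) = 1 := by rw [hσv, hu]
  have vσu' : Valued.v (σ u') = 1 := by rw [hσv, hu']
  have hsw : σ w = w⁻¹ := by rw [← mul_eq_one_iff_eq_inv₀ hw0]; exact hσw
  have hsw' : σ w' = w'⁻¹ := by rw [← mul_eq_one_iff_eq_inv₀ hw0']; exact hσw'
  rw [inv_mul_mem_flickerHK_iff_of_coe_eq σ hJ hd hy m hum hp hp' hcoe hcoe' hu0 hw0 hu0']
  -- (1) ⟺ (1′)
  have e1 : Valued.v (u' / u - w' / w) = Valued.v (u * w⁻¹ - u' * w'⁻¹) := by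
    have : u' / u - w' / w = -((u * w)⁻¹ * w') * (u * w⁻¹ - u' * w'⁻¹) * w := by field_simp; ring
    rw [this, map_mul, map_mul, Valuation.map_neg, map_mul, map_inv₀, map_mul, hu, hw, hw', one_mul, inv_one, one_mul, one_mul, mul_one]
  -- (2) follows from (1): `(σα)⁻¹ − β = −(σα)⁻¹ β σ(α − β)`
  have e2 : Valued.v ((σ (u' / u))⁻¹ - w' / w) = Valued.v (u' / u - w' / w) := by
    have hid : (σ (u' / u))⁻¹ - w' / w = -((σ (u' / u))⁻¹ * (w' / w)) * σ (u' / u - w' / w) := by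
      rw [map_sub, map_div₀, map_div₀, hsw, hsw']; field_simp; ring
    rw [hid, map_mul, Valuation.map_neg, map_mul, map_inv₀, map_div₀, map_div₀, vσu', vσu, div_one, inv_one, one_mul, map_div₀, hw', hw,
      div_one, one_mul, hσv]
  -- (3) ⟺ (3′): multiply by the unit `u σu′`
  have e3 : Valued.v (u' / u + u' / u * (x' - x * (u * σ u) / (u' * σ u')) + (σ (u' / u))⁻¹ - 2 * (w' / w)) =
      Valued.v (u' * σ u' * (1 + x') + u * σ u * (1 - x) - 2 * (u * σ u' * (w' * w⁻¹))) := by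
    have hid : u' * σ u' * (1 + x') + u * σ u * (1 - x) - 2 * (u * σ u' * (w' * w⁻¹)) =
        (u * σ u') * (u' / u + u' / u * (x' - x * (u * σ u) / (u' * σ u')) + (σ (u' / u))⁻¹ - 2 * (w' / w)) := by
      rw [map_div₀]; field_simp; ring
    rw [hid, map_mul, map_mul, hu, vσu', one_mul, one_mul]
  rw [e2, e1, e3]
  constructor
  · rintro ⟨h1, -, h3⟩; exact ⟨h1, h3⟩
  · rintro ⟨h1, h3⟩; exact ⟨h1, h1, h3⟩

end Cosets

end UnitaryGroup

end Literature.NumberTheory.Automorphic
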